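/- Width seat `ym-line-sfw-p2-w5` (prover-ym-line-sfw-p2-w5-g18-0), free hands on planner ym-idea-2 g16's LINE-19 entry kit
(crux `AllWindowsColdBox.BoxHighWindowsSU22` = stmt-QuantumFields-24004 / low item 24335): stub S2 BY NAME. -/
import Summits.QuantumFields.YangMills.Theorems.AllWindowsColdBoxBoxHighWindowsSU22LineDefs
import Summits.QuantumFields.YangMills.Theorems.AllWindowsColdBoxDirProjKernelHodgeForm

/-!
# LINE-19 stub S2 by name: `stub_kernelHodgeForm : DirProjKernelHodgeForm` (the forest-gauge projection kernel is the Hodge/Landau kernel)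

The registered stub S2 of LINE-19 (skeleton v9 `f1519a877fd86581`, `Cruxes/BoxHighWindowsSU22/Lines/landau_sector_relative_bl.lean`):
for `H ≥ 1` and plaquettes `p, q`, `boxDirProjKernel H p q = landauCoeff H p ⬝ᵥ ((hodgeQ H)⁻¹ *ᵥ landauCoeff H q)` — the Dirichlet
projection kernel of the temporal-forest gauge equals the bilinear form of the inverse HODGE precision matrix `Q_L + Σ_x g_x g_xᵀ` on the
Landau free edges (gauge change forest ↦ Landau).  It is a one-line instance of the generic gauge-change theorem
✓`AllWindowsColdBox.HodgeForm.boxDirProjKernel_eq_hodgeForm` (p707757, seat w5 g17) at the line's data `landauPin`, `interiorSites`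
(`interiorSites_iff`: coordinate form), `gradVec`; `hodgeQ_posDef` comes for free from ✓`HodgeForm.hodgeForm_posDef`.
Lean text: planner ym-idea-2 g16's checked draft `l26/S2-by-name-DRAFT.lean`; this seat re-checked it against the landed line-defs module.
HONEST LABEL: ONE registered stub (S2, the easiest of seven) of a critic-PASSed line on the R2ξ″ RECORD-rung crux 24004 / 24335; no crux,
rung or summit is proved; the Yang–Mills mass gap is NOT proved by this file.
-/

set_option autoImplicit false

namespace Summit.QuantumFields.YangMills.Theorems.AllWindowsColdBoxBoxHighLine

/-- Interior sites, coordinate form. -/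
theorem interiorSites_iff (H : ℕ) (x : Literature.Probability.LatticeModels.Site 4) :
    x ∈ interiorSites H ↔ ∀ k : Fin 4, 1 ≤ x k ∧ x k + 1 ≤ 2 * (H : ℤ) := by
  simp only [interiorSites, Fintype.mem_piFinset, Finset.mem_Icc]
  exact forall_congr' fun k => by omega

/-- **LINE-19 S2 by name**: the forest-gauge Dirichlet projection kernel is the Hodge (Landau) kernel. -/
theorem stub_kernelHodgeForm : DirProjKernelHodgeForm := fun H _ p q =>
  Summit.QuantumFields.YangMills.Theorems.AllWindowsColdBox.HodgeForm.boxDirProjKernel_eq_hodgeForm H (landauPin H)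
    (fun _ => Iff.rfl) (interiorSites H) (interiorSites_iff H) (gradVec H) (fun _ _ => rfl) p q

/-- `hodgeQ H` is positive definite (for free, same generic lemma). -/
theorem hodgeQ_posDef (H : ℕ) : (hodgeQ H).PosDef :=
  Summit.QuantumFields.YangMills.Theorems.AllWindowsColdBox.HodgeForm.hodgeForm_posDef H (landauPin H)
    (fun _ => Iff.rfl) (interiorSites H) (interiorSites_iff H) (gradVec H) (fun _ _ => rfl)

/-! ## Appendix (same seat, appended): invertibility and symmetry of `hodgeQ` -/

/-- `det (hodgeQ H)` is a unit (`hodgeQ` is positive definite), so `(hodgeQ H)⁻¹` is a genuine two-sided inverse. -/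
theorem isUnit_hodgeQ_det (H : ℕ) : IsUnit (hodgeQ H).det :=
  isUnit_iff_ne_zero.2 (hodgeQ_posDef H).det_pos.ne'

/-- `hodgeQ H` is symmetric. -/
theorem hodgeQ_transpose (H : ℕ) : (hodgeQ H).transpose = hodgeQ H := by
  unfold hodgeQ Literature.MathematicalPhysics.QuantumFieldTheory.LatticeMaxwell.Qmat
  rw [Matrix.transpose_add, Matrix.transpose_sum, Matrix.transpose_sum]
  simp [Matrix.transpose_vecMulVec]

/-- The inverse `(hodgeQ H)⁻¹` is symmetric. -/
theorem hodgeQ_inv_transpose (H : ℕ) : ((hodgeQ H)⁻¹).transpose = (hodgeQ H)⁻¹ := by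
  rw [Matrix.transpose_nonsing_inv, hodgeQ_transpose]

/-- Registry re-tick of S2 on the LOW item ⟨stmt-QuantumFields-24335⟩ (first filed for ⟨24004⟩ only, ✓p722049): the gauge change
`boxDirProjKernel = λ_p·hodgeQ⁻¹λ_q`, restated as a usable `example` (no new declaration). -/
example : DirProjKernelHodgeForm := stub_kernelHodgeForm

end Summit.QuantumFields.YangMills.Theorems.AllWindowsColdBoxBoxHighLine
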